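import Literature.NumberTheory.GaloisRepresentations.PontryaginTateDualInverseLimitScalars
import Literature.NumberTheory.IwasawaTheory.Greenberg2006.CohomologyCofiniteGenerationAssembly
import Literature.NumberTheory.GaloisRepresentations.LabelledHodgeTateWeights
import HarnessLib

/-!
# Greenberg's compact dual `T* = Hom(𝐃, μ_{p^∞})` in the arena of `SelmerGroupStructure.lean`:
# the torsion layers `𝐃[𝔪ᵏ]`, the dual pairing, and `LOC_v⁽¹⁾ ⟹ (T*)^{Γ_{K_v}} = 0`

Topic `NumberTheory/IwasawaTheory/Greenberg2016`; namespace
`Literature.NumberTheory.IwasawaTheory.Greenberg2016`. Definitions WITH BODIES and theorems; no named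
fact, no `sorry`, no instance, no notation. Seat `bsd-line-x1-p1-w4` gen 18 (prover, width seat of cell
`bsd-eis`), brick C1 (tail) of the road memo «SUR-Λ» (crux `GoodLatticeBDPValue`,
stmt-BirchSwinnertonDyer-19032; target `prop263_sur_of_crk_caseC_tc`).

For the standing data of `prop263_sur_of_crk` — `Λ ≅ ℤ_p⟦T₁,…,T_m⟧`, `𝐃` a discrete `Λ`-module with
a continuous `Λ`-linear action `ρ` of `G_{K,Σ}` — this file instantiates the generic construction of
`PontryaginTateDualInverseLimit{,Scalars}.lean`:

* `toDiscreteGaloisModule ρ : DiscreteGaloisModule K D` — `𝐃` as a `ℤ`-linear discrete `Γ_K`-module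
  through `Γ_K → G_{K,Σ}` (so that `localRep S ρ v σ = (toDiscreteGaloisModule ρ) (absGaloisRestrict … σ)`,
  `localRep_eq_toDiscreteGaloisModule`);
* **`torsionLayers ρ e hD : (toDiscreteGaloisModule ρ).TorsionLayers p`** — the layers `𝐃[𝔪ᵏ]`
  (Greenberg 2010 p. 6: `D[𝔪]`; 2016 §4.1: `𝐃[𝔪]`), an exhaustive chain of finite stable `p^k`-torsion
  subgroups when `𝐃` is cofinitely generated (`Greenberg2006.IsCofinitelyGenerated.forall_exists_pow_and_finite_of_ringEquiv_mvPowerSeries`,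
  `p ∈ 𝔪`: `natCast_mem_maximalIdeal_of_ringEquiv_mvPowerSeries`); the layers are `Λ`-submodules
  (`smul_mem_torsionLayers`) and the scalars commute with `Γ_K` (`toDiscreteGaloisModule_smul`);
* **`isDualPairing_evalDual`** — with the `Λ`-module structure `E.limitModule Λ hΛ` (installed by
  `letI`), `E.evalDual : T* →+ (D →+ K̄ˣ)` is a dual datum in the sense of the dictionary
  (`IsDualPairing Λ D E.evalDual`): `T* = lim_k Hom(𝐃[𝔪ᵏ], μ_{p^k})` IS "the" `T* = Hom(𝐃, μ_{p^∞})` of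
  (G2)/(G4), so `LOC1`, `tateDualInvariants`, `LOC2` speak about it;
* `TorsionLayers.dualEndHomComap φ θ` — the scalar `θ̂` as a `TopRep` endomorphism of the restricted
  system `T*|_H` (generic complement to part II, for the local `H¹(θ̂)`);
* **`eq_zero_of_LOC1`** — `LOC_v⁽¹⁾(𝐃)` ("`H⁰(K_v, T*) = 0`") ⟹ every element of `T*` fixed by the
  decomposition group `Γ_{K_v}` (acting through `absGaloisRestrict K K_v`) is `0`: the hypothesis (i)
  of Greenberg 2010 Props. 2.1.1 / 2.3.2 in the currency of the tree's
  `ContinuousH1TorsionOfInjectiveEndomorphism` (`hH0`); `mem_tateDualInvariants_iff_limitRep_eq`.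

HONESTY. Infrastructure only; nothing here proves Prop. 2.6.3 / 3.2.1, SUR, or any summit statement;
BSD is not advanced. AI-typed, kernel-checked.

## References
* R. Greenberg, *Surjectivity of the global-to-local map defining a Selmer group*, Kyoto J. Math. 50
  (2010) 853–888, §2 p. 6 L1–12 (`T*`, `D[𝔪]`), Prop. 2.1.1 (pp. 7–8), Prop. 2.3.2 (p. 13). [Greenberg2010]
* R. Greenberg, *On the structure of Selmer groups*, Springer PROMS 188 (2016) 225–252, §2 p. 5 L15–35,
  §2.1 p. 6 L1–10 (LOC_v⁽¹⁾, LOC_v⁽²⁾), §4.1 p. 15 (`𝐃[𝔪]`). [Greenberg2016Selmer]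
-/

noncomputable section

open scoped Classical
open Function NumberField IsDedekindDomain Field IsLocalRing
open Literature.NumberTheory.GaloisRepresentations
open Literature.NumberTheory.GaloisRepresentations.DiscreteGaloisModule
open Literature.NumberTheory.IwasawaTheory.Greenberg2006

/-! ### Generic complement to part II: the scalar endomorphism on the restricted system `T*|_H` -/

namespace Literature.NumberTheory.GaloisRepresentations.DiscreteGaloisModule.TorsionLayers

variable {K : Type} [Field K] {D : Type} [AddCommGroup D] [TopologicalSpace D] [DiscreteTopology D]
  {τ : DiscreteGaloisModule K D} {p : ℕ} (E : τ.TorsionLayers p)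
  {H : Type} [Group H] [TopologicalSpace H] (φ : H →ₜ* Field.absoluteGaloisGroup K)
  (θ : D →+ D) (hθ : ∀ (k : ℕ), ∀ d ∈ E.N k, θ d ∈ E.N k)
  (hθτ : ∀ (σ : Field.absoluteGaloisGroup K) (d : D), θ (τ σ d) = τ σ (θ d))

/-- **`θ̂` as an endomorphism of the restricted topological representation `T*|_H`** (the system
`E.dualSystem.comap φ`, e.g. `φ = absGaloisRestrict K K_v`): the same map `E.dualEnd θ hθ`, for
`cohomologyMap … 1` = the scalar on `H¹_cont(H, T*)`. [cite: Greenberg2010, §2 p. 6 L5–8, (8) p. 8] -/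
def dualEndHomComap :
    (E.dualSystem.comap φ).limitRep.toTopRep ⟶ (E.dualSystem.comap φ).limitRep.toTopRep :=
  TopRep.ofHom ⟨⟨(E.dualEnd θ hθ).toIntLinearMap, E.continuous_dualEnd θ hθ⟩, fun h =>
    ContinuousLinearMap.ext fun x => by exact E.dualEnd_limitRep θ hθ hθτ (φ h) x⟩

/-- Unfolding `dualEndHomComap`. [cite: Greenberg2010, §2 p. 6 L5–8] -/
@[simp] theorem dualEndHomComap_hom_apply (x : (E.dualSystem.comap φ).limit) :
    (E.dualEndHomComap φ θ hθ hθτ).hom x = E.dualEnd θ hθ x := rfl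

end Literature.NumberTheory.GaloisRepresentations.DiscreteGaloisModule.TorsionLayers

namespace Literature.NumberTheory.IwasawaTheory.Greenberg2016

variable {K : Type} [Field K] [NumberField K] {S : Set (HeightOneSpectrum (𝓞 K))}
  {Λ : Type} [CommRing Λ] [TopologicalSpace Λ]
  {D : Type} [AddCommGroup D] [Module Λ D] [TopologicalSpace D] [DiscreteTopology D]
  (ρ : ContinuousRep (GaloisGroupUnramifiedOutside K S) Λ D)

/-! ### `𝐃` as a `ℤ`-linear discrete `Γ_K`-module -/

/-- **`𝐃` as a discrete `Γ_K`-module**: `ρ` restricted along `Γ_K → G_{K,Σ}` with scalars restricted to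
`ℤ` (the currency of the tree's Galois cohomology / Poitou–Tate files and of
`DiscreteGaloisModule.TorsionLayers`). [cite: Greenberg2010, §2 p. 6 L1–4] -/
def toDiscreteGaloisModule : DiscreteGaloisModule K D :=
  ContinuousRep.restrictScalars ℤ (ρ.restrict (toUnramifiedQuotCont K S))

omit [NumberField K] in
/-- Unfolding: `Γ_K` acts on `𝐃` through `Γ_K → G_{K,Σ}`. [cite: Greenberg2010, §2 p. 6 L1–4] -/
@[simp] theorem toDiscreteGaloisModule_apply (σ : absoluteGaloisGroup K) (d : D) :
    toDiscreteGaloisModule ρ σ d = ρ (toUnramifiedQuotCont K S σ) d := rfl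

omit [NumberField K] in
/-- The scalars of `Λ` commute with the `Γ_K`-action on `𝐃`. [cite: Greenberg2010, §2 p. 6 L5–8] -/
theorem toDiscreteGaloisModule_smul (σ : absoluteGaloisGroup K) (r : Λ) (d : D) :
    toDiscreteGaloisModule ρ σ (r • d) = r • toDiscreteGaloisModule ρ σ d := by
  rw [toDiscreteGaloisModule_apply, toDiscreteGaloisModule_apply, map_smul]

/-- **The decomposition group acts on `𝐃` through `Γ_{K_v} → Γ_K`**: `localRep S ρ v σ` is
`toDiscreteGaloisModule ρ` at `absGaloisRestrict K K_v σ`. [cite: Greenberg2016Selmer, §1 p. 3 L26–28] -/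
theorem localRep_eq_toDiscreteGaloisModule (v : Place K) (σ : absoluteGaloisGroup v.Completion) (d : D) :
    localRep S ρ v σ d = toDiscreteGaloisModule ρ (absGaloisRestrict K v.Completion σ) d := rfl

/-! ### The torsion layers `𝐃[𝔪ᵏ]` -/

section Layers

variable {p : ℕ} [Fact p.Prime] {m : ℕ} [IsLocalRing Λ]

/-- **The layers `𝐃[𝔪ᵏ]` of a cofinitely generated discrete `Λ`-module, `Λ ≅ ℤ_p⟦T₁,…,T_m⟧`**, as
torsion layers of the discrete `Γ_K`-module `𝐃`: increasing (`𝔪ᵏ⁺¹ ≤ 𝔪ᵏ`), `Γ_K`-stable (`ρ` is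
`Λ`-linear), killed by `p^k` (`p ∈ 𝔪`), finite and exhaustive (cofinite generation, Greenberg 2006 §3 A:
"`C[𝔪]` is finite. Also, `D = ⋃ D[𝔪ⁿ]`"). [cite: Greenberg2010, §2 p. 6 L1–12] [cite: Greenberg2016Selmer, §4.1 p. 15 L27–29] -/
def torsionLayers (e : Λ ≃+* MvPowerSeries (Fin m) ℤ_[p]) (hD : IsCofinitelyGenerated Λ D) :
    (toDiscreteGaloisModule ρ).TorsionLayers p where
  N k := (Submodule.torsionBySet Λ D ((maximalIdeal Λ ^ k : Ideal Λ) : Set Λ)).restrictScalars ℤ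
  mono := fun k l hkl d hd => by
    rw [Submodule.restrictScalars_mem, Submodule.mem_torsionBySet_iff] at hd ⊢
    rintro ⟨r, hr⟩
    exact hd ⟨r, Ideal.pow_le_pow_right hkl hr⟩
  stable := fun k σ d hd => by
    rw [Submodule.mem_comap, Submodule.restrictScalars_mem, Submodule.mem_torsionBySet_iff]
    rw [Submodule.restrictScalars_mem, Submodule.mem_torsionBySet_iff] at hd
    rintro ⟨r, hr⟩
    change r • toDiscreteGaloisModule ρ σ d = 0
    rw [← toDiscreteGaloisModule_smul, hd ⟨r, hr⟩, map_zero]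
  torsion := fun k d hd => by
    rw [Submodule.restrictScalars_mem, Submodule.mem_torsionBySet_iff] at hd
    have h := hd ⟨(p : Λ) ^ k, Ideal.pow_mem_pow (natCast_mem_maximalIdeal_of_ringEquiv_mvPowerSeries e) k⟩
    rw [← Nat.cast_smul_eq_nsmul Λ, Nat.cast_pow]
    exact h
  finite := fun k => (hD.forall_exists_pow_and_finite_of_ringEquiv_mvPowerSeries e).2 k
  exhaustive := fun d => by
    obtain ⟨k, hk⟩ := (hD.forall_exists_pow_and_finite_of_ringEquiv_mvPowerSeries e).1 d
    refine ⟨k, ?_⟩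
    rw [Submodule.restrictScalars_mem, Submodule.mem_torsionBySet_iff]
    rintro ⟨r, hr⟩
    exact hk r hr

omit [NumberField K] in
/-- Membership in the `k`-th layer: `d ∈ 𝐃[𝔪ᵏ]`. [cite: Greenberg2010, §2 p. 6 L1–12] -/
theorem mem_torsionLayers_iff (e : Λ ≃+* MvPowerSeries (Fin m) ℤ_[p]) (hD : IsCofinitelyGenerated Λ D)
    (k : ℕ) (d : D) :
    d ∈ (torsionLayers ρ e hD).N k ↔ ∀ r ∈ maximalIdeal Λ ^ k, r • d = 0 := by
  change d ∈ (Submodule.torsionBySet Λ D _).restrictScalars ℤ ↔ _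
  rw [Submodule.restrictScalars_mem, Submodule.mem_torsionBySet_iff]
  exact ⟨fun h r hr => h ⟨r, hr⟩, fun h r => h r.1 r.2⟩

omit [NumberField K] in
/-- **The layers `𝐃[𝔪ᵏ]` are `Λ`-submodules** (the hypothesis `hΛ` of `TorsionLayers.limitModule`).
[cite: Greenberg2010, §2 p. 6 L5–8] -/
theorem smul_mem_torsionLayers (e : Λ ≃+* MvPowerSeries (Fin m) ℤ_[p]) (hD : IsCofinitelyGenerated Λ D)
    (k : ℕ) (r : Λ) (d : D) (hd : d ∈ (torsionLayers ρ e hD).N k) :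
    r • d ∈ (torsionLayers ρ e hD).N k := by
  rw [mem_torsionLayers_iff] at hd ⊢
  intro s hs
  rw [smul_smul, mul_comm, ← smul_smul, hd s hs, smul_zero]

end Layers

/-! ### `T*` is a Pontryagin/Tate dual datum of `𝐃` in the sense of the dictionary -/

section Pairing

variable {p : ℕ} (E : (toDiscreteGaloisModule ρ).TorsionLayers p)
  (hΛ : ∀ (k : ℕ) (r : Λ), ∀ d ∈ E.N k, r • d ∈ E.N k)

omit [NumberField K] in
/-- **`T* = lim_k Hom(D_k, μ_{p^k})` with its evaluation `T* → Hom(𝐃, K̄ˣ)` is a dual datum for `𝐃`**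
(`IsDualPairing Λ 𝐃 evalDual`: bijective onto `Hom(𝐃, K̄ˣ)` and `Λ`-balanced, `(r·x)(d) = x(r·d)`),
for the `Λ`-module structure `E.limitModule Λ hΛ` — so the dictionary's `LOC1`, `tateDualInvariants`,
`LOC2` (G4) apply to this `T*`. [cite: Greenberg2016Selmer, §2 p. 5 L15–35] [cite: Greenberg2010, §2 p. 6 L1–12] -/
theorem isDualPairing_evalDual :
    letI := E.limitModule Λ hΛ
    IsDualPairing Λ D E.evalDual := by
  letI := E.limitModule Λ hΛ
  exact ⟨E.evalDual_bijective, fun r x d => E.evalDual_smul Λ hΛ r x d⟩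

/-- **`LOC_v⁽¹⁾(𝐃) ⟹ (T*)^{Γ_{K_v}} = 0`**: if every `Γ_{K_v}`-equivariant additive `𝐃 → K̄ˣ` vanishes
(`LOC1 S ρ v`, "`H⁰(K_v, T*) = 0`"), an element of `T*` fixed by the decomposition group (acting through
`absGaloisRestrict K K_v`) is `0` — hypothesis (i) of Greenberg 2010 Props. 2.1.1 / 2.3.2 (c).
[cite: Greenberg2010, Prop. 2.1.1 (p. 7 L24–27), Prop. 2.3.2 (p. 13 L26–28)] [cite: Greenberg2016Selmer, §2.1 p. 6 L5] -/
theorem eq_zero_of_LOC1 (v : Place K) (h1 : LOC1 S ρ v) (x : E.dualSystem.limit)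
    (hx : ∀ σ : absoluteGaloisGroup v.Completion,
      E.dualSystem.limitRep (absGaloisRestrict K v.Completion σ) x = x) :
    x = 0 :=
  E.eq_zero_of_forall_limitRep_eq_self (absGaloisRestrict K v.Completion) h1 x hx

/-- The same for the restricted system `E.dualSystem.comap (absGaloisRestrict K K_v)` = `T*|_{Γ_{K_v}}`
(`hH0` of the tree's `ContinuousH1TorsionOf…`). [cite: Greenberg2010, Prop. 2.1.1 (p. 7 L24 – p. 8 L6)] -/
theorem eq_zero_of_LOC1_comap (v : Place K) (h1 : LOC1 S ρ v)
    (x : (E.dualSystem.comap (absGaloisRestrict K v.Completion)).limit)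
    (hx : ∀ σ : absoluteGaloisGroup v.Completion,
      (E.dualSystem.comap (absGaloisRestrict K v.Completion)).limitRep σ x = x) :
    x = 0 :=
  E.eq_zero_of_forall_comap_limitRep_eq_self (absGaloisRestrict K v.Completion) h1 x hx

/-- **`(T*)^{Γ_{K_v}} = tateDualInvariants`**: for the dual datum `evalDual`, an element of `T*` lies in
the dictionary's `Λ`-submodule `tateDualInvariants S ρ v` iff it is fixed by the decomposition group.
[cite: Greenberg2016Selmer, §2.1 p. 6 L1–6] -/
theorem mem_tateDualInvariants_iff_limitRep_eq (v : Place K) (x : E.dualSystem.limit) :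
    letI := E.limitModule Λ hΛ
    x ∈ tateDualInvariants S ρ v E.evalDual (isDualPairing_evalDual ρ E hΛ) ↔
      ∀ σ : absoluteGaloisGroup v.Completion,
        E.dualSystem.limitRep (absGaloisRestrict K v.Completion σ) x = x := by
  letI := E.limitModule Λ hΛ
  rw [mem_tateDualInvariants_iff]
  exact ⟨fun h σ => (E.limitRep_apply_eq_self_iff _ x).2 (h σ),
    fun h σ => (E.limitRep_apply_eq_self_iff _ x).1 (h σ)⟩

end Pairing

end Literature.NumberTheory.IwasawaTheory.Greenberg2016

end
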